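import Literature.AlgebraicGeometry.Modules.SheafHom
import HarnessLib

/-!
# The internal Hom functor `𝓗om_{𝒪_X}(E, –)`, its global sections, evaluation and biduality

Continuation of `Modules/SheafHom.lean` (the `𝒪_X`-module `𝓗om(E, M)`, `U ↦ Hom(E|_U, M|_U)`,
Hartshorne II Ex. 1.15 / II.5 p. 109). Everything here is a construction or a proved lemma:

* `sheafHomMap E f : 𝓗om(E, M) ⟶ 𝓗om(E, N)` (post-composition with `f|_U`) and the additive
  functor `sheafHomFunctor E : X.Modules ⥤ X.Modules`;
* `unitModule X : X.Modules` — Mathlib's `SheafOfModules.unit X.ringCatSheaf` (= `𝒪_X`) typed in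
  `X.Modules`; `homSection f`, `unitToSheafHom f : 𝒪_X ⟶ 𝓗om(E, M)` (the global section `f`),
  and the **unit** `sheafHomUnit E : 𝒪_X ⟶ 𝓔nd(E)`, `a ↦ a · id` (`sheafHomUnit_app_apply`);
* `evalAt s : 𝓗om(E, M)|_U ⟶ M|_U` — evaluation at a section `s ∈ Γ(E, U)`, additive and
  `𝒪(U)`-linear in `s`, compatible with restriction;
* `toBidual E M : E ⟶ 𝓗om(𝓗om(E, M), M)`, `s ↦ (φ ↦ φ(s))` — for `M = 𝒪_X` the biduality map
  `E → E^∨∨` of Hartshorne II Ex. 5.1 (a).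

Exactness of `𝓗om(E, –)` for `E` finite locally free is `Modules/SheafHomExact.lean`.

## References

* R. Hartshorne, *Algebraic Geometry*, GTM 52 (1977): II Ex. 1.15 (p. 67), II.5 (p. 109),
  II Ex. 5.1 (p. 123). [Hartshorne1977]
-/

noncomputable section

open CategoryTheory AlgebraicGeometry Opposite TopologicalSpace Limits

namespace Literature.AlgebraicGeometry.Modules

universe u

variable {X : Scheme.{u}}

/-! ### Functoriality of `𝓗om(E, M)` in `M` -/

section Functor

variable (E : X.Modules) {M N P : X.Modules} {U : X.Opens}

/-- Sections of `𝓗om(E, M)` over `U` are morphisms `E|_U ⟶ M|_U` (definitional unfolding, stated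
as an equivalence for readability of later constructions). [folklore] -/
def sheafHomSectionsEquiv (M : X.Modules) (U : X.Opens) :
    Γ(sheafHom E M, U) ≃ (E.over U ⟶ M.over U) := Equiv.refl _

/-- Post-composition with `f : M → N`: the morphism `𝓗om(E, M) → 𝓗om(E, N)`, `φ ↦ φ ≫ f|_U` on
sections over `U`. [cite: Hartshorne1977, II Ex. 1.15 and II.5 p. 109] -/
def sheafHomMap (f : M ⟶ N) : sheafHom E M ⟶ sheafHom E N where
  val := PresheafOfModules.homMk
    { app := fun U => AddCommGrpCat.ofHom
        { toFun := fun φ : E.over U.unop ⟶ M.over U.unop =>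
            φ ≫ (SheafOfModules.overFunctor _ U.unop).map f
          map_zero' := zero_comp
          map_add' := fun φ ψ => Preadditive.add_comp _ _ _ φ ψ _ }
      naturality := fun {U V} i => by
        refine AddCommGrpCat.ext fun (φ : E.over U.unop ⟶ M.over U.unop) => ?_
        change restrictHom i.unop φ ≫ (SheafOfModules.overFunctor _ V.unop).map f =
          restrictHom i.unop (φ ≫ (SheafOfModules.overFunctor _ U.unop).map f)
        rw [restrictHom_comp, restrictHom_over_map] }
    (fun U (a : Γ(X, U.unop)) (φ : E.over U.unop ⟶ M.over U.unop) => by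
      change (a • φ) ≫ (SheafOfModules.overFunctor _ U.unop).map f =
        a • (φ ≫ (SheafOfModules.overFunctor _ U.unop).map f)
      rw [smul_overHom_def, smul_overHom_def, Category.assoc, Category.assoc,
        over_map_overScalar])

/-- Sections of `sheafHomMap E f`: `φ ↦ φ ≫ f|_U`. [folklore] -/
@[simp]
lemma sheafHomMap_app_apply (f : M ⟶ N) (U : X.Opens) (φ : E.over U ⟶ M.over U) :
    (sheafHomMap E f).app U φ = φ ≫ (SheafOfModules.overFunctor _ U).map f := rfl

/-- Values of `φ ≫ f|_U`: apply `φ`, then `f`. [folklore] -/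
lemma appLE_comp_over_map (φ : E.over U ⟶ M.over U) (f : M ⟶ N) {W : X.Opens} (k : W ⟶ U)
    (s : Γ(E, W)) :
    appLE (φ ≫ (SheafOfModules.overFunctor _ U).map f) k s = f.app W (appLE φ k s) := rfl

/-- `𝓗om(E, 𝟙) = 𝟙`. [folklore] -/
@[simp]
lemma sheafHomMap_id (M : X.Modules) : sheafHomMap E (𝟙 M) = 𝟙 (sheafHom E M) := by
  refine Scheme.Modules.hom_ext _ _ fun U => AddCommGrpCat.ext fun (φ : E.over U ⟶ M.over U) =>
    hom_ext_of_appLE fun W k s => ?_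
  change appLE (φ ≫ (SheafOfModules.overFunctor _ U).map (𝟙 M)) k s = appLE φ k s
  rw [appLE_comp_over_map]
  rfl

/-- `𝓗om(E, f ≫ g) = 𝓗om(E, f) ≫ 𝓗om(E, g)`. [folklore] -/
lemma sheafHomMap_comp (f : M ⟶ N) (g : N ⟶ P) :
    sheafHomMap E (f ≫ g) = sheafHomMap E f ≫ sheafHomMap E g := by
  refine Scheme.Modules.hom_ext _ _ fun U => AddCommGrpCat.ext fun (φ : E.over U ⟶ M.over U) =>
    hom_ext_of_appLE fun W k s => ?_
  change appLE (φ ≫ (SheafOfModules.overFunctor _ U).map (f ≫ g)) k s =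
    appLE ((φ ≫ (SheafOfModules.overFunctor _ U).map f) ≫
      (SheafOfModules.overFunctor _ U).map g) k s
  rw [appLE_comp_over_map, appLE_comp_over_map, appLE_comp_over_map]
  rfl

/-- `𝓗om(E, f + g) = 𝓗om(E, f) + 𝓗om(E, g)`. [folklore] -/
lemma sheafHomMap_add (f g : M ⟶ N) :
    sheafHomMap E (f + g) = sheafHomMap E f + sheafHomMap E g := by
  refine Scheme.Modules.hom_ext _ _ fun U => AddCommGrpCat.ext fun (φ : E.over U ⟶ M.over U) =>
    hom_ext_of_appLE fun W k s => ?_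
  change appLE (φ ≫ (SheafOfModules.overFunctor _ U).map (f + g)) k s =
    appLE ((φ ≫ (SheafOfModules.overFunctor _ U).map f) +
      (φ ≫ (SheafOfModules.overFunctor _ U).map g)) k s
  rw [appLE_add, appLE_comp_over_map, appLE_comp_over_map, appLE_comp_over_map]
  rfl

/-- **The internal Hom functor `𝓗om_{𝒪_X}(E, –) : Mod(𝒪_X) ⥤ Mod(𝒪_X)`.**
[cite: Hartshorne1977, II Ex. 1.15 and II.5 p. 109] -/
def sheafHomFunctor : X.Modules ⥤ X.Modules where
  obj M := sheafHom E M
  map f := sheafHomMap E f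
  map_id M := sheafHomMap_id E M
  map_comp f g := sheafHomMap_comp E f g

/-- `𝓗om(E, –)` on objects. [folklore] -/
@[simp]
lemma sheafHomFunctor_obj (M : X.Modules) : (sheafHomFunctor E).obj M = sheafHom E M := rfl

/-- `𝓗om(E, –)` on morphisms. [folklore] -/
@[simp]
lemma sheafHomFunctor_map (f : M ⟶ N) : (sheafHomFunctor E).map f = sheafHomMap E f := rfl

/-- `𝓗om(E, –)` is an additive functor. [folklore] -/
instance sheafHomFunctor_additive : (sheafHomFunctor E).Additive where
  map_add := sheafHomMap_add E _ _

end Functor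

/-! ### Global sections of `𝓗om(E, M)`: morphisms `E → M`; the unit `𝒪_X → 𝓔nd(E)` -/

/-- The structure sheaf `𝒪_X` as an object of the category `X.Modules` (Mathlib's
`SheafOfModules.unit X.ringCatSheaf`, retyped so that morphisms out of it are morphisms of
`X.Modules`). [folklore] -/
abbrev unitModule (X : Scheme.{u}) : X.Modules := SheafOfModules.unit X.ringCatSheaf

section Sections

variable {E M : X.Modules}

/-- A morphism `f : E → M` of `𝒪_X`-modules defines a global section `U ↦ f|_U` of `𝓗om(E, M)`.
[folklore] -/
def homSection (f : E ⟶ M) : (sheafHom E M).sections :=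
  PresheafOfModules.sectionsMk (M := homPresheaf E M)
    (fun U => ((SheafOfModules.overFunctor _ U.unop).map f : E.over U.unop ⟶ M.over U.unop))
    (fun _ _ i => restrictHom_over_map i.unop f)

/-- The value of `homSection f` at `U` is `f|_U`. [folklore] -/
@[simp]
lemma homSection_eval (f : E ⟶ M) (U : (X.Opens)ᵒᵖ) :
    (homSection f).eval U = ((SheafOfModules.overFunctor _ U.unop).map f :
      E.over U.unop ⟶ M.over U.unop) := rfl

/-- The morphism `𝒪_X → 𝓗om(E, M)` picking out the global section `f`. [folklore] -/
def unitToSheafHom (f : E ⟶ M) : unitModule X ⟶ sheafHom E M :=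
  (sheafHom E M).unitHomEquiv.symm (homSection f)

variable (E) in
/-- **The unit `𝒪_X → 𝓔nd(E) = 𝓗om(E, E)`**, `a ↦ a · id_E`. [cite: Hartshorne1977, II Ex. 5.1] -/
def sheafHomUnit : unitModule X ⟶ sheafHom E E :=
  unitToSheafHom (𝟙 E)

/-- Sections of `unitToSheafHom f`: `a ↦ a • f|_U`. [folklore] -/
lemma unitToSheafHom_app_apply (f : E ⟶ M) (U : X.Opens) (a : Γ(X, U)) :
    (unitToSheafHom f).app U a =
      (a • (SheafOfModules.overFunctor _ U).map f : E.over U ⟶ M.over U) := by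
  rfl

/-- Sections of the unit: `a ↦ a • 𝟙 = overScalar a`. [folklore] -/
lemma sheafHomUnit_app_apply (U : X.Opens) (a : Γ(X, U)) :
    (sheafHomUnit E).app U a = (overScalar E U a : E.over U ⟶ E.over U) := by
  change (unitToSheafHom (𝟙 E)).app U a = _
  rw [unitToSheafHom_app_apply, smul_overHom_def]
  exact hom_ext_of_appLE fun W k s => rfl

end Sections

/-! ### Evaluation at a section and biduality -/

section Eval

variable {E M : X.Modules} {U V : X.Opens}

/-- **Evaluation at a section** `s ∈ Γ(E, U)`: the morphism `𝓗om(E, M)|_U → M|_U`,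
`φ ↦ φ_W(s|_W)` on sections over `W ≤ U`. [folklore] -/
def evalAt (s : Γ(E, U)) : (sheafHom E M).over U ⟶ M.over U where
  val := PresheafOfModules.homMk
    { app := fun W => AddCommGrpCat.ofHom
        { toFun := fun φ : E.over W.unop.left ⟶ M.over W.unop.left =>
            appLE φ (𝟙 _) (E.presheaf.map W.unop.hom.op s)
          map_zero' := appLE_zero _ _
          map_add' := fun φ ψ => appLE_add φ ψ _ _ }
      naturality := fun {W W'} g => by
        refine AddCommGrpCat.ext fun (φ : E.over W.unop.left ⟶ M.over W.unop.left) => ?_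
        change appLE (restrictHom g.unop.left φ) (𝟙 _) (E.presheaf.map W'.unop.hom.op s) =
          M.presheaf.map g.unop.left.op (appLE φ (𝟙 _) (E.presheaf.map W.unop.hom.op s))
        rw [appLE_restrictHom, ← appLE_map, presheaf_map_map]
        rfl }
    (fun W (a : Γ(X, W.unop.left)) (φ : E.over W.unop.left ⟶ M.over W.unop.left) => by
      change appLE (a • φ) (𝟙 _) (E.presheaf.map W.unop.hom.op s) =
        a • appLE φ (𝟙 _) (E.presheaf.map W.unop.hom.op s)
      rw [appLE_smul, op_id, X.presheaf.map_id]
      rfl)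

/-- Values of `evalAt s`: `φ ↦ φ_W(s|_W)`. [folklore] -/
@[simp]
lemma appLE_evalAt (s : Γ(E, U)) {W : X.Opens} (k : W ⟶ U)
    (φ : E.over W ⟶ M.over W) :
    appLE (evalAt (M := M) s) k (φ : Γ(sheafHom E M, W)) = appLE φ (𝟙 W) (E.presheaf.map k.op s) :=
  rfl

/-- Evaluation is compatible with restriction of the section. [folklore] -/
lemma restrictHom_evalAt (i : V ⟶ U) (s : Γ(E, U)) :
    restrictHom i (evalAt (M := M) s) = evalAt (E.presheaf.map i.op s) := by
  refine hom_ext_of_appLE fun W k (φ : E.over W ⟶ M.over W) => ?_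
  rw [appLE_restrictHom, appLE_evalAt, appLE_evalAt, presheaf_map_map]

/-- Evaluation is additive in the section. [folklore] -/
lemma evalAt_add (s t : Γ(E, U)) :
    evalAt (M := M) (s + t) = evalAt s + evalAt t := by
  refine hom_ext_of_appLE fun W k (φ : E.over W ⟶ M.over W) => ?_
  rw [appLE_add, appLE_evalAt, appLE_evalAt, appLE_evalAt, map_add, appLE_add_right]

/-- Evaluation is `𝒪_X(U)`-linear in the section: `ev_{a s} = a • ev_s`. [folklore] -/
lemma evalAt_smul (a : Γ(X, U)) (s : Γ(E, U)) :
    evalAt (M := M) (a • s) = a • evalAt s := by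
  refine hom_ext_of_appLE fun W k (φ : E.over W ⟶ M.over W) => ?_
  rw [appLE_smul, appLE_evalAt, appLE_evalAt, Scheme.Modules.map_smul, appLE_smul_right]

variable (E M) in
/-- **Biduality / double-dual map into `M`**: the morphism `E → 𝓗om(𝓗om(E, M), M)`,
`s ↦ (φ ↦ φ(s))`; for `M = 𝒪_X` this is `E → E^∨∨` (Hartshorne II Ex. 5.1 (a): an isomorphism
for `E` locally free of finite rank). [cite: Hartshorne1977, II Ex. 5.1 (a)] -/
def toBidual : E ⟶ sheafHom (sheafHom E M) M where
  val := PresheafOfModules.homMk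
    { app := fun U => AddCommGrpCat.ofHom
        { toFun := fun s : Γ(E, U.unop) => (evalAt (M := M) s :
            (sheafHom E M).over U.unop ⟶ M.over U.unop)
          map_zero' := by
            have h := evalAt_add (M := M) (0 : Γ(E, U.unop)) 0
            rw [add_zero] at h
            exact (left_eq_add.mp h).symm ▸ rfl
          map_add' := evalAt_add }
      naturality := fun {U V} i => by
        refine AddCommGrpCat.ext fun (s : Γ(E, U.unop)) => ?_
        exact (restrictHom_evalAt (M := M) i.unop s).symm }
    (fun U a (s : Γ(E, U.unop)) => evalAt_smul (M := M) a s)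

/-- Sections of the biduality map: `s ↦ ev_s`. [folklore] -/
@[simp]
lemma toBidual_app_apply (U : X.Opens) (s : Γ(E, U)) :
    (toBidual E M).app U s = (evalAt (M := M) s : (sheafHom E M).over U ⟶ M.over U) := rfl

end Eval

end Literature.AlgebraicGeometry.Modules

end
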